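import Summits.KontsevichZagierPeriods.KontsevichZagierPeriods.Theses.AbelContraction
import Summits.KontsevichZagierPeriods.KontsevichZagierPeriods.Theses.LowDimension
import Literature.NumberTheory.Transcendental.KZCalculusProofs
import Literature.NumberTheory.Transcendental.SemialgebraicMapsProofs

/-!
# KontsevichZagierPeriods / AbelContraction — areas to arcs (item stmt-KontsevichZagierPeriods-0117)

Settles the support item stmt-KontsevichZagierPeriods-0117 (`lowdim_huber_wustholz_transfer`),
wanted by route AbelContraction as `AreasToArcs` and by route LowDimension as
`LowdimHuberWustholzTransfer` (same signature): *if any two integrand-`1` planar representations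
(`KZ.IntegralRep 2`) of equal value (= two `ℚ`-semialgebraic planar sets of equal finite area) are
`KZ.Equivalent`, then any two one-dimensional representations `r r' : KZ.IntegralRep 1` of equal
value are `KZ.Equivalent`.*

## Proof (only the printed rules (1) and (3) of Kontsevich–Zagier, §1.2)

For `r = (σ, f)`:
* rule (1b), additivity of the integrand: `[σ, f + |f|] = [σ, f] + [σ, |f|]`;
* rule (3), Newton–Leibniz along the last coordinate with primitive `F (x, t) = t`:
  `[σ, f + |f|] ≡ [U, 1]` for the band `U = {(x, t) | x ∈ σ, 0 ≤ t ≤ f x + |f x|}` and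
  `[σ, |f|] ≡ [L, 1]` for the band `L = {(x, t) | x ∈ σ, -|f x| - 1 ≤ t ≤ -1}` (put below the
  level `t = -1` so that upper and lower bands are disjoint);
so `[r] ≡ [U] − [L]` modulo `KZ.relations`, and likewise `[r'] ≡ [U'] − [L']`. The glued
representations `G = U ⊔ L'`, `G' = U' ⊔ L` (rule (1a), disjoint domains) have integrand `1` and,
by soundness of the moves and `r.value = r'.value`, equal values; the hypothesis gives
`[G] ≡ [G']`, whence `[r] − [r'] ≡ ([U] + [L']) − ([U'] + [L]) ≡ [G] − [G'] ≡ 0`.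

Finiteness of the area of a band `{(x, t) | x ∈ σ, a x ≤ t ≤ b x}` is the exact formula
`volume = ∫⁻_σ (b − a)` (Fubini along the last coordinate, `volume_eq_lintegral_of_snoc_mem_iff`);
semialgebraicity of the bands is Tarski–Seidenberg (`tarski_seidenberg_real_holds`, proved in the
tree). Everything is stated for a base of arbitrary dimension `n` and specialised to `n = 1`.

Sources: M. Kontsevich, D. Zagier, *Periods* (2001), §1.1 (area under the graph), §1.2 (rules
(1)–(3)). Deliberately NOT here: anything about the planar hypothesis itself (crux `PlanarAreas`,
item stmt-KontsevichZagierPeriods-4990); this file is the glue only.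
-/

noncomputable section

open MeasureTheory Set
open Literature.NumberTheory.Transcendental

namespace Summit.KontsevichZagierPeriods.AbelContraction.AreasToArcs

variable {n : ℕ}

/-- **Area of a band.** If `B ⊆ ℝⁿ⁺¹` is measurable and its fibres along the last coordinate are
`B ∩ ({x} × ℝ) = [a x, b x]` for `x ∈ σ` and `∅` otherwise, then
`volume B = ∫⁻ x in σ, (b x − a x)` (identify `ℝⁿ⁺¹ ≃ ℝ × ℝⁿ` by the volume-preserving
`MeasurableEquiv.piFinSuccAbove _ (Fin.last n)` and use `Measure.prod_apply_symm`).
[Kontsevich–Zagier 2001, §1.1 ("the integral … is equal to the area under its graph")] [folklore] -/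
theorem volume_eq_lintegral_of_snoc_mem_iff {σ : Set (Fin n → ℝ)} (hσ : MeasurableSet σ)
    {a b : (Fin n → ℝ) → ℝ} {B : Set (Fin (n + 1) → ℝ)} (hB : MeasurableSet B)
    (hmem : ∀ (x : Fin n → ℝ) (t : ℝ),
      (Fin.snoc x t : Fin (n + 1) → ℝ) ∈ B ↔ x ∈ σ ∧ t ∈ Icc (a x) (b x)) :
    volume B = ∫⁻ x in σ, ENNReal.ofReal (b x - a x) := by
  set e : (Fin (n + 1) → ℝ) ≃ᵐ ℝ × (Fin n → ℝ) :=
    MeasurableEquiv.piFinSuccAbove (fun _ => ℝ) (Fin.last n) with he_def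
  have he : MeasurePreserving e volume volume :=
    volume_preserving_piFinSuccAbove (fun _ => ℝ) (Fin.last n)
  have he_symm : ∀ p : ℝ × (Fin n → ℝ), e.symm p = Fin.snoc p.2 p.1 := fun p => by
    simp [he_def, MeasurableEquiv.piFinSuccAbove, Fin.snocEquiv]
  rw [← (he.symm e).measure_preimage_equiv B, Measure.volume_eq_prod,
    Measure.prod_apply_symm (e.symm.measurable hB), ← lintegral_indicator hσ]
  refine lintegral_congr fun x => ?_
  by_cases hx : x ∈ σ
  · have hset : (fun t : ℝ => (t, x)) ⁻¹' (e.symm ⁻¹' B) = Icc (a x) (b x) := by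
      ext t
      rw [mem_preimage, mem_preimage, he_symm, hmem]
      simp [hx]
    rw [hset, indicator_of_mem hx, Real.volume_Icc]
  · have hset : (fun t : ℝ => (t, x)) ⁻¹' (e.symm ⁻¹' B) = ∅ := by
      ext t
      rw [mem_preimage, mem_preimage, he_symm, hmem]
      simp [hx]
    rw [hset, indicator_of_notMem hx, measure_empty]

/-- **The band representation and its Newton–Leibniz move.** For a representation `q = (σ, g)`
and `ℚ`-semialgebraic functions `a ≤ b` on `σ` with `g = b − a` on `σ`, the band
`{(x, t) | x ∈ σ, a x ≤ t ≤ b x}` with integrand `1` is an integral representation `U` of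
dimension `n + 1` (its area is `∫_σ (b − a) = ∫_σ g < ∞`), and `[U] − [q]` is a single instance of
printed rule (3) (Newton–Leibniz along the last coordinate, primitive `F (x, t) = t`).
[Kontsevich–Zagier 2001, §1.1 remark, §1.2 rule (3)] [cite: KontsevichZagier2001, §1.2] -/
theorem exists_band_sub_mem_newtonLeibnizRel (q : KZ.IntegralRep n) (a b : (Fin n → ℝ) → ℝ)
    (ha : IsSemialgebraicFunOn ℚ q.domain a) (hb : IsSemialgebraicFunOn ℚ q.domain b)
    (hab : ∀ x ∈ q.domain, a x ≤ b x) (hq : ∀ x ∈ q.domain, q.integrand x = b x - a x) :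
    ∃ U : KZ.IntegralRep (n + 1),
      U.domain = {z : Fin (n + 1) → ℝ | (Fin.init z : Fin n → ℝ) ∈ q.domain ∧
        a (Fin.init z) ≤ z (Fin.last n) ∧ z (Fin.last n) ≤ b (Fin.init z)} ∧
      (∀ p ∈ U.domain, U.integrand p = 1) ∧ KZ.of U - KZ.of q ∈ KZ.newtonLeibnizRel := by
  set B : Set (Fin (n + 1) → ℝ) := {z : Fin (n + 1) → ℝ | (Fin.init z : Fin n → ℝ) ∈ q.domain ∧
    a (Fin.init z) ≤ z (Fin.last n) ∧ z (Fin.last n) ≤ b (Fin.init z)} with hB_def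
  have hTS : Literature.ModelTheory.ExponentialFields.tarski_seidenberg_real (k := ℚ) :=
    Literature.ModelTheory.ExponentialFields.tarski_seidenberg_real_holds
  -- the band is semialgebraic (Tarski–Seidenberg: epigraph of `a` ∩ hypograph of `b`)
  have hBsa : Literature.ModelTheory.ExponentialFields.IsSemialgebraic ℚ B := by
    convert (ha.isSemialgebraic_setOf_ge hTS).inter (hb.isSemialgebraic_setOf_le hTS) using 1
    ext z
    simp only [hB_def, mem_setOf_eq, mem_inter_iff]
    tauto
  have hBm : MeasurableSet B :=
    Literature.ModelTheory.ExponentialFields.IsSemialgebraic.measurableSet_holds hBsa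
  have hσm : MeasurableSet q.domain := KZ.IntegralRep.measurableSet_domain_holds q
  have hmemB : ∀ (x : Fin n → ℝ) (t : ℝ),
      (Fin.snoc x t : Fin (n + 1) → ℝ) ∈ B ↔ x ∈ q.domain ∧ t ∈ Icc (a x) (b x) := by
    intro x t
    simp only [hB_def, mem_setOf_eq, Fin.init_snoc, Fin.snoc_last, mem_Icc]
  -- the band has finite area `∫_σ (b - a) = ∫_σ g ≤ ∫_σ |g| < ∞`
  have hfin : ∫⁻ x in q.domain, ‖q.integrand x‖ₑ < ⊤ := q.integrableOn.2
  have hvol : volume B ≠ ⊤ := by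
    rw [volume_eq_lintegral_of_snoc_mem_iff hσm hBm hmemB]
    refine ne_top_of_le_ne_top hfin.ne (setLIntegral_mono' hσm fun x hx => ?_)
    rw [← hq x hx]
    exact Real.ofReal_le_enorm _
  -- the representation
  obtain ⟨U, hUd, hUi⟩ : ∃ U : KZ.IntegralRep (n + 1), U.domain = B ∧ U.integrand = fun _ => 1 :=
    ⟨{ domain := B
       integrand := fun _ => 1
       isSemialgebraic_domain := hBsa
       isSemialgebraicFunOn_integrand :=
         (isSemialgebraicFunOn_natCast hBsa 1).congr fun _ _ => by simp
       integrableOn := integrableOn_const hvol }, rfl, rfl⟩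
  refine ⟨U, hUd, fun p _ => by simp [hUi], ?_⟩
  refine ⟨n, U, q, a, b, fun z => z (Fin.last n), ?_, ha, hb, hab, hUd, ?_, ?_, ?_, rfl⟩
  · -- the primitive `F = X_last` is a polynomial, hence semialgebraic on the band
    rw [hUd]
    exact (isSemialgebraicFunOn_aeval hBsa (MvPolynomial.X (Fin.last n))).congr
      fun z _ => by simp
  · -- continuity of `t ↦ t` on the closed fibre
    intro x _
    simp only [Fin.snoc_last]
    exact continuousOn_id
  · -- `d/dt t = 1` = the integrand of `U` on the open fibre
    intro x _ t _
    simp only [Fin.snoc_last, hUi]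
    exact hasDerivAt_id' t
  · -- the boundary term `b x - a x` is the integrand of `q`
    intro x hx
    simp only [Fin.snoc_last]
    exact hq x hx

/-- **Sign splitting by rule (1b).** For `r = (σ, f)` the representations `r₁ = (σ, f + |f|)` and
`r₂ = (σ, |f|)` exist (sums and absolute values of semialgebraic integrable functions are
semialgebraic and integrable) and `[r₁] − [r] − [r₂]` is a single instance of additivity in the
integrand. [Kontsevich–Zagier 2001, §1.2 rule (1)] [cite: KontsevichZagier2001, §1.2] -/
theorem exists_addAbs_abs_sub_mem_integrandAddRel (r : KZ.IntegralRep n) :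
    ∃ r₁ r₂ : KZ.IntegralRep n, r₁.domain = r.domain ∧ r₂.domain = r.domain ∧
      (∀ x ∈ r.domain, r₁.integrand x = r.integrand x + |r.integrand x|) ∧
      (∀ x ∈ r.domain, r₂.integrand x = |r.integrand x|) ∧
      KZ.of r₁ - KZ.of r - KZ.of r₂ ∈ KZ.integrandAddRel := by
  have habs : IsSemialgebraicFunOn ℚ r.domain (fun x => |r.integrand x|) :=
    r.isSemialgebraicFunOn_integrand.abs
  have hadd : IsSemialgebraicFunOn ℚ r.domain (fun x => r.integrand x + |r.integrand x|) :=
    (IsSemialgebraicFunOn.add_holds r.isSemialgebraicFunOn_integrand habs).congr fun _ _ => rfl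
  have hi_abs : IntegrableOn (fun x => |r.integrand x|) r.domain := Integrable.abs r.integrableOn
  have hi_add : IntegrableOn (fun x => r.integrand x + |r.integrand x|) r.domain :=
    Integrable.add r.integrableOn hi_abs
  let r₁ : KZ.IntegralRep n :=
    { domain := r.domain
      integrand := fun x => r.integrand x + |r.integrand x|
      isSemialgebraic_domain := r.isSemialgebraic_domain
      isSemialgebraicFunOn_integrand := hadd
      integrableOn := hi_add }
  let r₂ : KZ.IntegralRep n :=
    { domain := r.domain
      integrand := fun x => |r.integrand x|
      isSemialgebraic_domain := r.isSemialgebraic_domain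
      isSemialgebraicFunOn_integrand := habs
      integrableOn := hi_abs }
  exact ⟨r₁, r₂, rfl, rfl, fun _ _ => rfl, fun _ _ => rfl, n, r₁, r, r₂, rfl, rfl,
    fun _ _ => rfl, rfl⟩

/-- **One-dimensional (indeed `n`-dimensional) representations as differences of areas.** Every
representation `r = (σ, f)` satisfies `[r] ≡ [U] − [L]` modulo `KZ.relations` for two
integrand-`1` representations of dimension `n + 1`: the band `U` under the graph of `f + |f|`
(above the level `t = 0`) and the band `L` of thickness `|f|` hanging below the level `t = -1`
(rules (1b) and (3)). [Kontsevich–Zagier 2001, §1.1 remark, §1.2] [cite: KontsevichZagier2001, §1.2] -/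
theorem exists_upper_lower (r : KZ.IntegralRep n) :
    ∃ U L : KZ.IntegralRep (n + 1),
      (∀ p ∈ U.domain, U.integrand p = 1) ∧ (∀ p ∈ L.domain, L.integrand p = 1) ∧
      (∀ p ∈ U.domain, 0 ≤ p (Fin.last n)) ∧ (∀ p ∈ L.domain, p (Fin.last n) ≤ -1) ∧
      KZ.of r - (KZ.of U - KZ.of L) ∈ KZ.relations := by
  obtain ⟨r₁, r₂, h₁, h₂, hf₁, hf₂, hadd⟩ := exists_addAbs_abs_sub_mem_integrandAddRel r
  -- the upper band: `0 ≤ t ≤ f x + |f x|` over `r₁ = (σ, f + |f|)`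
  obtain ⟨U, hUd, hU1, hUm⟩ := exists_band_sub_mem_newtonLeibnizRel r₁ (fun _ => 0) r₁.integrand
    ((isSemialgebraicFunOn_natCast r₁.isSemialgebraic_domain 0).congr fun _ _ => by simp)
    r₁.isSemialgebraicFunOn_integrand
    (fun x hx => by
      have hx' : x ∈ r.domain := h₁ ▸ hx
      show (0 : ℝ) ≤ r₁.integrand x
      rw [hf₁ x hx']
      linarith [neg_abs_le (r.integrand x)])
    (fun x _ => by simp)
  -- the lower band: `-|f x| - 1 ≤ t ≤ -1` over `r₂ = (σ, |f|)`
  obtain ⟨L, hLd, hL1, hLm⟩ := exists_band_sub_mem_newtonLeibnizRel r₂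
    (fun x => -r₂.integrand x - 1) (fun _ => -1)
    ((IsSemialgebraicFunOn.sub_holds r₂.isSemialgebraicFunOn_integrand.neg
      (isSemialgebraicFunOn_natCast r₂.isSemialgebraic_domain 1)).congr fun _ _ => by simp)
    ((isSemialgebraicFunOn_natCast r₂.isSemialgebraic_domain 1).neg.congr fun _ _ => by simp)
    (fun x hx => by
      have hx' : x ∈ r.domain := h₂ ▸ hx
      show -r₂.integrand x - 1 ≤ (-1 : ℝ)
      rw [hf₂ x hx']
      linarith [abs_nonneg (r.integrand x)])
    (fun x _ => by
      show r₂.integrand x = (-1 : ℝ) - (-r₂.integrand x - 1)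
      ring)
  refine ⟨U, L, hU1, hL1, fun p hp => ?_, fun p hp => ?_, ?_⟩
  · rw [hUd] at hp
    exact hp.2.1
  · rw [hLd] at hp
    exact hp.2.2
  · have : KZ.of r - (KZ.of U - KZ.of L) =
        (KZ.of L - KZ.of r₂) - (KZ.of r₁ - KZ.of r - KZ.of r₂) - (KZ.of U - KZ.of r₁) := by
      abel
    rw [this]
    exact KZ.relations.sub_mem (KZ.relations.sub_mem (KZ.newtonLeibnizRel_subset_relations hLm)
      (KZ.integrandAddRel_subset_relations hadd)) (KZ.newtonLeibnizRel_subset_relations hUm)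

/-- **Areas to arcs** (item stmt-KontsevichZagierPeriods-0117 with its hypothesis explicit). If
any two integrand-`1` planar representations of equal value are `KZ.Equivalent`, then any two
one-dimensional representations `r`, `r'` of equal value are `KZ.Equivalent`: write
`[r] ≡ [U] − [L]`, `[r'] ≡ [U'] − [L']` (`exists_upper_lower`), glue the disjoint bands
`G = U ⊔ L'`, `G' = U' ⊔ L` by rule (1a); these have integrand `1` and equal areas (soundness of
the moves), so `[G] ≡ [G']` by hypothesis and `[r] − [r'] ≡ [G] − [G'] ≡ 0`.
[Kontsevich–Zagier 2001, §1.1–1.2] [cite: KontsevichZagier2001, §1.2] -/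
theorem equivalent_of_value_eq_of_planarAreas
    (hP : ∀ (s s' : KZ.IntegralRep 2), (∀ p ∈ s.domain, s.integrand p = 1) →
      (∀ p ∈ s'.domain, s'.integrand p = 1) → s.value = s'.value → KZ.Equivalent s s')
    (r r' : KZ.IntegralRep 1) (hv : r.value = r'.value) : KZ.Equivalent r r' := by
  obtain ⟨U, L, hU1, hL1, hU0, hL0, hr⟩ := exists_upper_lower r
  obtain ⟨U', L', hU1', hL1', hU0', hL0', hr'⟩ := exists_upper_lower r'
  have hd : Disjoint U.domain L'.domain := Set.disjoint_left.mpr fun p hpU hpL => by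
    have h0 := hU0 p hpU
    have h1 := hL0' p hpL
    linarith
  have hd' : Disjoint U'.domain L.domain := Set.disjoint_left.mpr fun p hpU hpL => by
    have h0 := hU0' p hpU
    have h1 := hL0 p hpL
    linarith
  -- the glued representations (rule (1a))
  have hG1 : ∀ p ∈ (U.glue L' hd).domain, (U.glue L' hd).integrand p = 1 := by
    rintro p (hp | hp)
    · rw [KZ.IntegralRep.eqOn_integrand_glue_left U L' hd hp]
      exact hU1 p hp
    · rw [KZ.IntegralRep.eqOn_integrand_glue_right U L' hd hp]
      exact hL1' p hp
  have hG1' : ∀ p ∈ (U'.glue L hd').domain, (U'.glue L hd').integrand p = 1 := by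
    rintro p (hp | hp)
    · rw [KZ.IntegralRep.eqOn_integrand_glue_left U' L hd' hp]
      exact hU1' p hp
    · rw [KZ.IntegralRep.eqOn_integrand_glue_right U' L hd' hp]
      exact hL1 p hp
  have hGm := KZ.domainAddRel_subset_relations
    (KZ.IntegralRep.of_glue_sub_sub_mem_domainAddRel U L' hd)
  have hGm' := KZ.domainAddRel_subset_relations
    (KZ.IntegralRep.of_glue_sub_sub_mem_domainAddRel U' L hd')
  -- equal areas, by soundness of the moves
  have key : ∀ c ∈ KZ.relations, KZ.eval c = 0 := fun c hc =>
    AddMonoidHom.mem_ker.mp (KZ.relations_le_ker_eval_holds hc)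
  have hval : (U.glue L' hd).value = (U'.glue L hd').value := by
    have e₁ := key _ hr
    have e₂ := key _ hr'
    have e₃ := key _ hGm
    have e₄ := key _ hGm'
    simp only [map_sub, KZ.eval_of] at e₁ e₂ e₃ e₄
    linarith
  have hPG : KZ.of (U.glue L' hd) - KZ.of (U'.glue L hd') ∈ KZ.relations :=
    hP _ _ hG1 hG1' hval
  -- bookkeeping in the formal group
  show KZ.of r - KZ.of r' ∈ KZ.relations
  have : KZ.of r - KZ.of r' =
      (KZ.of r - (KZ.of U - KZ.of L)) - (KZ.of r' - (KZ.of U' - KZ.of L')) +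
        (KZ.of (U.glue L' hd) - KZ.of (U'.glue L hd')) -
        (KZ.of (U.glue L' hd) - KZ.of U - KZ.of L') +
        (KZ.of (U'.glue L hd') - KZ.of U' - KZ.of L) := by
    abel
  rw [this]
  exact KZ.relations.add_mem (KZ.relations.sub_mem
    (KZ.relations.add_mem (KZ.relations.sub_mem hr hr') hPG) hGm) hGm'

/-- Route AbelContraction, item stmt-KontsevichZagierPeriods-0117: the route declaration
`AreasToArcs` (planar equal-area equivalence ⇒ equivalence of equal-valued one-dimensional
representations) holds; it is `equivalent_of_value_eq_of_planarAreas` read through the route's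
definition. [Kontsevich–Zagier 2001, §1.1–1.2] [cite: KontsevichZagier2001, §1.2] -/
theorem areasToArcs_proof :
    Summit.KontsevichZagierPeriods.KontsevichZagierPeriods.Theses.AbelContraction.AreasToArcs := by
  unfold Summit.KontsevichZagierPeriods.KontsevichZagierPeriods.Theses.AbelContraction.AreasToArcs
  exact equivalent_of_value_eq_of_planarAreas

/-- Route LowDimension, item stmt-KontsevichZagierPeriods-0117: the route declaration
`LowdimHuberWustholzTransfer` (same statement as `AbelContraction.AreasToArcs`) holds; it is
`equivalent_of_value_eq_of_planarAreas` read through the route's definition.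
[Kontsevich–Zagier 2001, §1.1–1.2] [cite: KontsevichZagier2001, §1.2] -/
theorem lowdimHuberWustholzTransfer_proof :
    Summit.KontsevichZagierPeriods.KontsevichZagierPeriods.Theses.LowDimension.LowdimHuberWustholzTransfer := by
  unfold Summit.KontsevichZagierPeriods.KontsevichZagierPeriods.Theses.LowDimension.LowdimHuberWustholzTransfer
  exact equivalent_of_value_eq_of_planarAreas

end Summit.KontsevichZagierPeriods.AbelContraction.AreasToArcs

end
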